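/-
Copyright (c) 2026 the pub-hodgecm-mathlib formalisation cell (harness21).  Prover seat hodgecm-mathlib-F0P3-p02 (g26), 2026-09-03.  E1 row 47c R-c «JACQUET FUNCTOR OF THE
SCHNEIDER–STUHLER RESOLUTION», FILE 2a «SHIFT MINUS IDENTITY ON A ℤ-GRADED SPACE» (E1 keeper ∕ dealer F0P3a-p03 (g29) 02:13:33Z; census row 47 §2 (A3), plan 02:20:35Z).
-/
import Mathlib.Algebra.DirectSum.Module
import Mathlib.LinearAlgebra.FiniteDimensional.Defs
import HarnessLib

/-!
# A degree-raising automorphism of a `ℤ`-graded vector space: `φ − 1` is injective and its cokernel is the degree-`0` piece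

Topic `LinearAlgebra`; declarations in the `LinearMap` namespace (deliberate dot-style extension, lean/CONVENTIONS.md §2).  THEOREMS ONLY (no definition, no instance, no notation,
no named fact, no `sorry`); Mathlib only.  Cell `pub/hodgecm-mathlib` (D-0151), crux H413 = `stmt-HodgeConjecture-24833`, lane `--supports`; E1 BRICK LEDGER row 47c FILE 2a (the
algebra of «`EP_T ≡ 0`» in census row 47 §2 (A3): the Jacquet module `(C_q)_N` of a chain module of the Schneider–Stuhler resolution is `⊕_{n ∈ ℤ} τ^n W_q`, graded by the height
of the `N`-orbits, and the torus element `τ` SHIFTS the grading; then `r(τ) − 1` is injective with cokernel `≅ W_q`, which is what the snake lemma of row 47a consumes).  HONEST LABEL: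
count-neutral generic base layer; (R-SS) NOT chartered; E1 = PRINT until the keeper's charter test; HC_CM is proved only modulo the 2 remaining named inputs (hLiu418 =
`stmt-HodgeConjecture-24832`, h413 = `stmt-HodgeConjecture-24833`) until rung 0 closes.

THE MATHEMATICS ([Brown1982, III §5 (induced modules over `ℤ`: `H₀(ℤ, k[ℤ] ⊗ W) = W`, `H₁ = 0`)]; [BernsteinZelevinsky1976, §2.3]).  `M = ⊕_{n ∈ ℤ} W_n` an internal direct sum of subspaces of a
`k`-vector space, `φ ∈ End(M)` injective with `φ(W_n) = W_{n+1}` for all `n`.  Then (§2) `φ − 1` is INJECTIVE (if `φ m = m ≠ 0`, look at the top degree `N` of `m`: the degree-`N+1`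
component of `φ m` is `φ(m_N) ≠ 0`, that of `m` is `0`); (§3) every `m` is congruent modulo `(φ − 1)M` to an element of `W₀` (`φ^n w ≡ w`: walk each homogeneous component to degree
`0`), and `W₀ ∩ (φ − 1)M = 0` (top ∕ bottom degree again); hence (§4) `W₀ → M ⧸ (φ − 1)M` is a linear BIJECTION and `dim M ⧸ (φ − 1)M = dim W₀`.  In other words: for the
`k[t, t⁻¹]`-module `M ≅ k[t^±] ⊗ W₀` (`t` acting by `φ`), `ker(t − 1) = 0` and `coker(t − 1) ≅ W₀` — `H₁(ℤ, ·) = 0`, `H₀(ℤ, ·) = W₀`.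

* §1 `exists_shift` — the shift `Ψ` on the external direct sum realising `φ` componentwise: `coe (Ψ c) = φ (coe c)` and `(Ψ c)_{n+1} = φ(c_n)`.
* §2 **`injective_sub_id_of_shift`** — `Function.Injective (φ - LinearMap.id)`.
* §3 `exists_mem_degZero_sub_mem_range` (every class meets `W₀`), `eq_zero_of_mem_degZero_of_mem_range` (`W₀ ∩ range (φ − 1) = 0`).
* §4 **`bijective_mkQ_comp_subtype_degZero`**, **`finrank_quotient_range_sub_id_eq`** — `finrank k (M ⧸ range (φ − 1)) = finrank k W₀`.

## References
* [Brown1982] K. S. Brown, *Cohomology of Groups* (1982): III §5–§6 (induced modules, Shapiro's lemma; homology of `ℤ` with coefficients in `k[ℤ] ⊗ W`).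
* [BernsteinZelevinsky1976] I. N. Bernstein, A. V. Zelevinsky, *Representations of the group GL(n, F)…*, Russian Math. Surveys 31 (1976): §2.3.
-/

set_option autoImplicit false

open scoped BigOperators DirectSum

namespace LinearMap

variable {k M : Type*} [Field k] [AddCommGroup M] [Module k M]
variable {Wn : ℤ → Submodule k M} {φ : M →ₗ[k] M}

/-! ## §1 The shift on the external direct sum -/

/-- **THE SHIFT.**  If `φ(W_n) ⊆ W_{n+1}` for all `n`, there is a linear `Ψ` on `⊕_n W_n` lifting `φ` (`Σ_n (Ψ c)_n = φ (Σ_n c_n)`) with `(Ψ c)_{n+1} = φ(c_n)`. [cite: Brown1982, III §5] -/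
theorem exists_shift (hφ : ∀ n, ∀ x ∈ Wn n, φ x ∈ Wn (n + 1)) :
    ∃ Ψ : (⨁ n, Wn n) →ₗ[k] (⨁ n, Wn n), (∀ c : ⨁ n, Wn n, DirectSum.coeLinearMap Wn (Ψ c) = φ (DirectSum.coeLinearMap Wn c)) ∧
      ∀ (c : ⨁ n, Wn n) (n : ℤ), ((Ψ c) (n + 1) : M) = φ ((c n : Wn n) : M) := by
  classical
  let L : ∀ n : ℤ, Wn n →ₗ[k] Wn (n + 1) := fun n => φ.restrict (hφ n)
  let Ψ : (⨁ n, Wn n) →ₗ[k] (⨁ n, Wn n) := DirectSum.toModule k ℤ _ fun n => DirectSum.lof k ℤ (fun n => ↥(Wn n)) (n + 1) ∘ₗ L n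
  have hΨlof : ∀ (n : ℤ) (x : Wn n), Ψ (DirectSum.lof k ℤ (fun n => ↥(Wn n)) n x) = DirectSum.lof k ℤ (fun n => ↥(Wn n)) (n + 1) (L n x) := fun n x => by
    change DirectSum.toModule k ℤ _ _ (DirectSum.lof k ℤ (fun n => ↥(Wn n)) n x) = _
    rw [DirectSum.toModule_lof]; rfl
  refine ⟨Ψ, fun c => ?_, fun c n => ?_⟩
  · have : DirectSum.coeLinearMap Wn ∘ₗ Ψ = φ ∘ₗ DirectSum.coeLinearMap Wn := by
      refine DirectSum.linearMap_ext k fun n => LinearMap.ext fun x => ?_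
      simp only [LinearMap.coe_comp, Function.comp_apply, hΨlof, DirectSum.coeLinearMap_lof]
      rfl
    exact LinearMap.congr_fun this c
  · -- componentwise, by induction over `c`
    induction c using DirectSum.induction_on with
    | zero => simp only [map_zero, DirectSum.zero_apply, ZeroMemClass.coe_zero]
    | of i x =>
      rw [← DirectSum.lof_eq_of k, hΨlof]
      simp only [DirectSum.lof_eq_of]
      by_cases hi : i = n
      · subst hi
        rw [DirectSum.of_eq_same, DirectSum.of_eq_same]
        rfl
      · rw [DirectSum.of_eq_of_ne _ _ _ (show n + 1 ≠ i + 1 by omega), DirectSum.of_eq_of_ne _ _ _ (Ne.symm hi), ZeroMemClass.coe_zero,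
          ZeroMemClass.coe_zero, map_zero]
    | add x y hx hy => simp only [map_add, DirectSum.add_apply, Submodule.coe_add, hx, hy]

/-! ## §2 `φ − 1` is injective -/

/-- **`φ − 1` IS INJECTIVE** for an injective degree-raising `φ` on `M = ⊕_{n ∈ ℤ} W_n` (`φ(W_n) ⊆ W_{n+1}`): a fixed vector `φ m = m` has vanishing top component.
[cite: Brown1982, III §5] [cite: BernsteinZelevinsky1976, §2.3] -/
theorem injective_sub_id_of_shift (h : DirectSum.IsInternal Wn) (hinj : Function.Injective φ) (hφ : ∀ n, ∀ x ∈ Wn n, φ x ∈ Wn (n + 1)) :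
    Function.Injective (φ - LinearMap.id : M →ₗ[k] M) := by
  classical
  obtain ⟨Ψ, hΨcoe, hΨcomp⟩ := exists_shift (Wn := Wn) hφ
  rw [← LinearMap.ker_eq_bot, Submodule.eq_bot_iff]
  intro m hm
  rw [LinearMap.mem_ker, LinearMap.sub_apply, LinearMap.id_apply, sub_eq_zero] at hm
  -- coordinates of `m`
  set e := LinearEquiv.ofBijective (DirectSum.coeLinearMap Wn) h with he
  set c := e.symm m with hc
  have hcm : DirectSum.coeLinearMap Wn c = m := e.apply_symm_apply m
  -- `Ψ c = c`
  have hΨc : Ψ c = c := by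
    apply h.1
    change DirectSum.coeLinearMap Wn (Ψ c) = DirectSum.coeLinearMap Wn c
    rw [hΨcoe, hcm, hm]
  -- the support of `c` is empty: look at its top degree `N`
  by_contra hne
  have hc0 : c ≠ 0 := by
    intro h0; apply hne; rw [← hcm, h0, map_zero]
  have hsupp : (DFinsupp.support c).Nonempty :=
    Finset.nonempty_iff_ne_empty.2 fun hemp => hc0 (DFinsupp.support_eq_empty.1 hemp)
  obtain ⟨N, hN, hNmax⟩ := Finset.exists_max_image (DFinsupp.support c) (fun n : ℤ => n) hsupp
  have hN1 : c (N + 1) = 0 := by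
    by_contra h1
    have := hNmax (N + 1) (DFinsupp.mem_support_iff.2 h1)
    omega
  have hcomp := hΨcomp c N
  rw [hΨc, hN1, ZeroMemClass.coe_zero] at hcomp
  have hcN : ((c N : Wn N) : M) = 0 := hinj (by rw [map_zero]; exact hcomp.symm)
  exact (DFinsupp.mem_support_iff.1 hN) (Subtype.ext hcN)

/-! ## §3 The cokernel of `φ − 1` is `W₀` -/

/-- Every HOMOGENEOUS vector is congruent to a vector of `W₀` modulo `(φ − 1)M` (`φ(W_n) = W_{n+1}`): walk the degree to `0`. [cite: Brown1982, III §5] -/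
theorem exists_mem_degZero_sub_mem_range_of_mem (hφ : ∀ n, (Wn n).map φ = Wn (n + 1)) :
    ∀ (n : ℤ) (m : M), m ∈ Wn n → ∃ w ∈ Wn 0, m - w ∈ LinearMap.range (φ - LinearMap.id) := by
  -- going down from positive degrees
  have hdown : ∀ (j : ℕ) (m : M), m ∈ Wn (j : ℤ) → ∃ w ∈ Wn 0, m - w ∈ LinearMap.range (φ - LinearMap.id) := by
    intro j
    induction j with
    | zero => intro m hm; exact ⟨m, by simpa using hm, by simp⟩
    | succ j ih =>
      intro m hm
      have hm' : m ∈ (Wn (j : ℤ)).map φ := by rw [hφ]; exact_mod_cast hm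
      obtain ⟨m', hm'mem, rfl⟩ := hm'
      obtain ⟨w, hw, hmw⟩ := ih m' hm'mem
      refine ⟨w, hw, ?_⟩
      have h1 : φ m' - m' ∈ LinearMap.range (φ - LinearMap.id) := LinearMap.mem_range.2 ⟨m', rfl⟩
      have : φ m' - w = (φ m' - m') + (m' - w) := by abel
      rw [this]
      exact Submodule.add_mem _ h1 hmw
  -- going up from negative degrees
  have hup : ∀ (j : ℕ) (m : M), m ∈ Wn (-(j : ℤ)) → ∃ w ∈ Wn 0, m - w ∈ LinearMap.range (φ - LinearMap.id) := by
    intro j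
    induction j with
    | zero => intro m hm; exact ⟨m, by simpa using hm, by simp⟩
    | succ j ih =>
      intro m hm
      have hφm : φ m ∈ Wn (-(j : ℤ)) := by
        have : φ m ∈ (Wn (-((j + 1 : ℕ) : ℤ))).map φ := ⟨m, hm, rfl⟩
        rw [hφ] at this
        have e : -((j + 1 : ℕ) : ℤ) + 1 = -(j : ℤ) := by push_cast; ring
        rwa [e] at this
      obtain ⟨w, hw, hmw⟩ := ih (φ m) hφm
      refine ⟨w, hw, ?_⟩
      have h1 : φ m - m ∈ LinearMap.range (φ - LinearMap.id) := LinearMap.mem_range.2 ⟨m, rfl⟩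
      have : m - w = -(φ m - m) + (φ m - w) := by abel
      rw [this]
      exact Submodule.add_mem _ (Submodule.neg_mem _ h1) hmw
  intro n m hm
  rcases Int.eq_nat_or_neg n with ⟨j, rfl | rfl⟩
  · exact hdown j m hm
  · exact hup j m hm

/-- **EVERY CLASS MEETS `W₀`**: for `M = ⊕_n W_n` with `φ(W_n) = W_{n+1}`, every `m` is congruent modulo `(φ − 1)M` to some `w ∈ W₀`. [cite: Brown1982, III §5] -/
theorem exists_mem_degZero_sub_mem_range (h : DirectSum.IsInternal Wn) (hφ : ∀ n, (Wn n).map φ = Wn (n + 1)) (m : M) :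
    ∃ w ∈ Wn 0, m - w ∈ LinearMap.range (φ - LinearMap.id) := by
  classical
  -- induction over the decomposition of `m`
  have hm : m ∈ iSup Wn := by rw [h.submodule_iSup_eq_top]; exact Submodule.mem_top
  refine Submodule.iSup_induction Wn (motive := fun m => ∃ w ∈ Wn 0, m - w ∈ LinearMap.range (φ - LinearMap.id)) hm
    (fun n m hmn => exists_mem_degZero_sub_mem_range_of_mem hφ n m hmn) ⟨0, Submodule.zero_mem _, by simp⟩ ?_
  rintro x y ⟨wx, hwx, hx⟩ ⟨wy, hwy, hy⟩
  refine ⟨wx + wy, Submodule.add_mem _ hwx hwy, ?_⟩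
  have : x + y - (wx + wy) = (x - wx) + (y - wy) := by abel
  rw [this]
  exact Submodule.add_mem _ hx hy

/-- **`W₀ ∩ (φ − 1)M = 0`** for an injective degree-raising `φ` (top degree: `φ(c_N) = c_{N+1} = 0` unless `N = −1`; bottom degree: `c_a = φ(c_{a−1}) = 0` unless `a = 0`).
[cite: Brown1982, III §5] -/
theorem eq_zero_of_mem_degZero_of_mem_range (h : DirectSum.IsInternal Wn) (hinj : Function.Injective φ) (hφ : ∀ n, ∀ x ∈ Wn n, φ x ∈ Wn (n + 1))
    {w : M} (hw0 : w ∈ Wn 0) (hw : w ∈ LinearMap.range (φ - LinearMap.id)) : w = 0 := by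
  classical
  obtain ⟨Ψ, hΨcoe, hΨcomp⟩ := exists_shift (Wn := Wn) hφ
  obtain ⟨m, rfl⟩ := hw
  set e := LinearEquiv.ofBijective (DirectSum.coeLinearMap Wn) h with he
  set c := e.symm m with hc
  have hcm : DirectSum.coeLinearMap Wn c = m := e.apply_symm_apply m
  -- `Ψ c - c = ι₀ w`
  have hkey : Ψ c - c = DirectSum.lof k ℤ (fun n => ↥(Wn n)) 0 ⟨_, hw0⟩ := by
    apply h.1
    change DirectSum.coeLinearMap Wn (Ψ c - c) = DirectSum.coeLinearMap Wn (DirectSum.lof k ℤ (fun n => ↥(Wn n)) 0 ⟨_, hw0⟩)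
    rw [map_sub, hΨcoe, hcm, DirectSum.coeLinearMap_lof]
    rfl
  -- components away from degree `0`: `φ(c_j) = c_{j+1}` for `j + 1 ≠ 0`
  have hcompj : ∀ j : ℤ, j + 1 ≠ 0 → φ ((c j : Wn j) : M) = ((c (j + 1) : Wn (j + 1)) : M) := by
    intro j hj
    have := congrArg (fun d : ⨁ n, Wn n => ((d (j + 1) : Wn (j + 1)) : M)) hkey
    simp only at this
    rw [DirectSum.sub_apply, Submodule.coe_sub, hΨcomp, DirectSum.lof_eq_of, DirectSum.of_eq_of_ne _ _ _ hj, ZeroMemClass.coe_zero,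
      sub_eq_zero] at this
    exact this
  -- if `c = 0` we are done
  by_cases hc0 : c = 0
  · have : m = 0 := by rw [← hcm, hc0, map_zero]
    rw [this, map_zero]
  exfalso
  have hsupp : (DFinsupp.support c).Nonempty :=
    Finset.nonempty_iff_ne_empty.2 fun hemp => hc0 (DFinsupp.support_eq_empty.1 hemp)
  obtain ⟨N, hN, hNmax⟩ := Finset.exists_max_image (DFinsupp.support c) (fun n : ℤ => n) hsupp
  obtain ⟨a, ha, hamin⟩ := Finset.exists_min_image (DFinsupp.support c) (fun n : ℤ => n) hsupp
  have hN1 : c (N + 1) = 0 := by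
    by_contra h1
    have := hNmax (N + 1) (DFinsupp.mem_support_iff.2 h1)
    omega
  have ha1 : c (a - 1) = 0 := by
    by_contra h1
    have := hamin (a - 1) (DFinsupp.mem_support_iff.2 h1)
    omega
  -- top degree: `N + 1 = 0`
  have hNeq : N + 1 = 0 := by
    by_contra hne
    have h1 := hcompj N hne
    rw [hN1, ZeroMemClass.coe_zero] at h1
    have hcN : ((c N : Wn N) : M) = 0 := hinj (by rw [map_zero]; exact h1)
    exact (DFinsupp.mem_support_iff.1 hN) (Subtype.ext hcN)
  -- bottom degree: `a = 0`
  have haeq : a = 0 := by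
    by_contra hne
    have h1 := hcompj (a - 1) (by omega)
    rw [ha1, ZeroMemClass.coe_zero, map_zero, sub_add_cancel] at h1
    have hca : ((c a : Wn a) : M) = 0 := h1.symm
    exact (DFinsupp.mem_support_iff.1 ha) (Subtype.ext hca)
  have hle : a ≤ N := hamin N hN
  omega

/-! ## §4 The bijection `W₀ → M ⧸ (φ − 1)M` and the dimension of the cokernel -/

/-- **`W₀ → M ⧸ (φ − 1)M` IS A LINEAR BIJECTION** for an injective `φ` with `φ(W_n) = W_{n+1}` on `M = ⊕_{n ∈ ℤ} W_n`. [cite: Brown1982, III §5] -/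
theorem bijective_mkQ_comp_subtype_degZero (h : DirectSum.IsInternal Wn) (hinj : Function.Injective φ) (hφ : ∀ n, (Wn n).map φ = Wn (n + 1)) :
    Function.Bijective ((LinearMap.range (φ - LinearMap.id)).mkQ ∘ₗ (Wn 0).subtype) := by
  have hφ' : ∀ n, ∀ x ∈ Wn n, φ x ∈ Wn (n + 1) := fun n x hx => by rw [← hφ n]; exact ⟨x, hx, rfl⟩
  constructor
  · rw [← LinearMap.ker_eq_bot, Submodule.eq_bot_iff]
    intro w hw
    rw [LinearMap.mem_ker, LinearMap.coe_comp, Function.comp_apply, Submodule.mkQ_apply, Submodule.Quotient.mk_eq_zero] at hw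
    exact Subtype.ext (eq_zero_of_mem_degZero_of_mem_range h hinj hφ' w.2 hw)
  · intro x
    obtain ⟨m, rfl⟩ := Submodule.mkQ_surjective _ x
    obtain ⟨w, hw, hmw⟩ := exists_mem_degZero_sub_mem_range h hφ m
    exact ⟨⟨w, hw⟩, ((Submodule.Quotient.eq _).2 hmw).symm⟩

/-- **`dim M ⧸ (φ − 1)M = dim W₀`**: the cokernel of `φ − 1` is the degree-`0` piece. [cite: Brown1982, III §5] [cite: BernsteinZelevinsky1976, §2.3] -/
theorem finrank_quotient_range_sub_id_eq (h : DirectSum.IsInternal Wn) (hinj : Function.Injective φ) (hφ : ∀ n, (Wn n).map φ = Wn (n + 1)) :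
    Module.finrank k (M ⧸ LinearMap.range (φ - LinearMap.id)) = Module.finrank k (Wn 0) :=
  (LinearEquiv.ofBijective _ (bijective_mkQ_comp_subtype_degZero h hinj hφ)).finrank_eq.symm

/-- The cokernel `M ⧸ (φ − 1)M` is finite-dimensional when `W₀` is. [cite: Brown1982, III §5] -/
theorem finiteDimensional_quotient_range_sub_id (h : DirectSum.IsInternal Wn) (hinj : Function.Injective φ) (hφ : ∀ n, (Wn n).map φ = Wn (n + 1))
    [FiniteDimensional k (Wn 0)] : FiniteDimensional k (M ⧸ LinearMap.range (φ - LinearMap.id)) :=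
  LinearEquiv.finiteDimensional (LinearEquiv.ofBijective _ (bijective_mkQ_comp_subtype_degZero h hinj hφ))

end LinearMap
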